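import Literature.NumberTheory.Automorphic.AutomorphicRepsGLSatakeFlathProofs
import HarnessLib

/-!
# Right translates of automorphic forms by elements centralising the archimedean group

Topic `NumberTheory/Automorphic`. For a general automorphy datum `𝒟` (Borel–Jacquet 1979, §4.1)
and an element `y ∈ G(𝔸_K)` commuting with the archimedean group `ι(G_∞)` (e.g. any finite-adelic
element, `AutomorphyDatum.commute_ofArch`), right translation `φ ↦ r(y) φ = (g ↦ φ (g y))`
(the linear map `LinearMap.funLeft ℂ ℂ (· * y)` on functions) commutes with everything
archimedean: with the Lie derivatives and the word action of `U(𝔤)`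
(`applyFree_comp_mul_right`, from `lieDeriv_comp_mul_right`), hence with the `Z(𝔤)`-orbit span
(`zOrbitSpan_comp_mul_right`) and the `K_∞`-translate span (`kTranslateSpan_comp_mul_right`).
Consequently `r(y)` preserves archimedean smoothness, `K_∞`-finiteness and `Z(𝔤)`-finiteness
(`IsArchSmooth.comp_mul_right`, `IsKFinite.comp_mul_right`, `IsZFinite.comp_mul_right`), left
`G(K)`-invariance (`IsLeftInvariant.rightTranslation`), level invariance up to conjugating the
level (`IsRightInvariantUnder.rightTranslation`), and moderate growth as soon as the height
satisfies `1 ⊔ ‖g y‖ ≤ C (1 ⊔ ‖g‖)` (`HasModerateGrowth.rightTranslation`). Altogether: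

* `IsAutomorphicForm.rightTranslation_of_commute` — if `y` centralises `ι(G_∞)`, the levels of
  `𝒟` are stable under `y`-conjugation up to refinement, and the height grows at most linearly
  under `g ↦ g y`, then `r(y) φ` is an automorphic form for every automorphic form `φ`
  (Borel–Jacquet 1979, 4.3: `𝒜` is stable under right translation by `G(𝔸_f)`; the first, easy
  half of BJ 4.3 (ii)), and its span-level form `automorphicForms_le_comap_rightTranslation`
  (`𝒜 ≤ 𝒜.comap r(y)`, the shape consumed by `IsStableSubmodule.finite_stable`).

The `GL_n` specialisation (levels `{1} × U₀` are conjugation-stable, and the height inequality is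
`one_sup_adelicHeightGL_mul_le` of `AdelicHeightGLProofs`) is `AutomorphicFormsGLTranslates`; the
`K_∞`-translates are treated in `AutomorphicFormsKTranslates`. Everything here is proved.

## References

* A. Borel, H. Jacquet, *Automorphic forms and automorphic representations*, Proc. Sympos. Pure
  Math. 33 (1979), part 1, §4.2–4.3 [BorelJacquet1979].
-/

-- Mathlib idiom (Mathlib/Algebra/Lie/OfAssociative.lean); needed to mention Lie subalgebras of matrix algebras
attribute [local instance 100] LieRing.ofAssociativeRing

open scoped MatrixGroups Matrix ContDiff

noncomputable section

namespace Literature.NumberTheory.Automorphic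

/-! ### Word action, `Z(𝔤)`- and `K`-spans under centralising right translations -/

section ArchCalculus

variable {A : Type*} [NormedCommRing A] [NormedAlgebra ℝ A] [NormedAlgebra ℚ A] [CompleteSpace A]
  [StarRing A] {N : Type*} [Fintype N] [DecidableEq N] {H : RealMatrixGroup A N}
  {G : Type*} [Group G] (ι : H.carrier →* G)

/-- **Iterated Lie derivatives commute with right translations by elements centralising `ι(H)`.**
Borel–Jacquet 1979, §4.3. [cite: BorelJacquet1979, §4.3] -/
theorem iterLieDeriv_comp_mul_right (w : List H.lie) (φ : G → ℂ) {y : G}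
    (hy : ∀ h : H.carrier, ι h * y = y * ι h) :
    iterLieDeriv ι w (fun g => φ (g * y)) = fun g => iterLieDeriv ι w φ (g * y) := by
  induction w with
  | nil => rfl
  | cons X w ih => rw [iterLieDeriv_cons, ih, lieDeriv_comp_mul_right ι X _ hy, iterLieDeriv_cons]

/-- **The word action of `U(𝔤)` commutes with right translations by elements centralising
`ι(H)`**: `p (r(y) φ) = r(y) (p φ)` for every non-commutative polynomial `p ∈ ℝ⟨𝔤⟩`.
Borel–Jacquet 1979, §4.3. [cite: BorelJacquet1979, §4.3] -/
theorem applyFree_comp_mul_right (p : FreeAlgebra ℝ H.lie) (φ : G → ℂ) {y : G}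
    (hy : ∀ h : H.carrier, ι h * y = y * ι h) :
    applyFree ι p (fun g => φ (g * y)) = fun g => applyFree ι p φ (g * y) := by
  unfold applyFree
  simp only [iterLieDeriv_comp_mul_right ι _ φ hy]
  rw [Finsupp.sum, Finsupp.sum]
  funext g
  rw [Finset.sum_apply, Finset.sum_apply]
  rfl

/-- The `Z(𝔤)`-orbit span of `r(y) φ` is the `r(y)`-image of that of `φ` (for `y` centralising
`ι(H)`). Borel–Jacquet 1979, §4.3. [cite: BorelJacquet1979, §4.3] -/
theorem zOrbitSpan_comp_mul_right (φ : G → ℂ) {y : G} (hy : ∀ h : H.carrier, ι h * y = y * ι h) :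
    zOrbitSpan ι (fun g => φ (g * y)) = (zOrbitSpan ι φ).map (LinearMap.funLeft ℂ ℂ fun g : G => g * y) := by
  unfold zOrbitSpan
  rw [Submodule.map_span]
  congr 1
  ext ψ
  constructor
  · rintro ⟨p, hp, rfl⟩
    exact ⟨applyFree ι p φ, ⟨p, hp, rfl⟩, (applyFree_comp_mul_right ι p φ hy).symm⟩
  · rintro ⟨_, ⟨p, hp, rfl⟩, rfl⟩
    exact ⟨p, hp, (applyFree_comp_mul_right ι p φ hy).symm⟩

/-- **`Z(𝔤)`-finiteness is preserved by right translations centralising `ι(H)`.**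
Borel–Jacquet 1979, §4.3. [cite: BorelJacquet1979, §4.3] -/
theorem IsZFinite.comp_mul_right {φ : G → ℂ} (hφ : IsZFinite ι φ) {y : G}
    (hy : ∀ h : H.carrier, ι h * y = y * ι h) : IsZFinite ι (fun g => φ (g * y)) := by
  unfold IsZFinite at hφ ⊢
  rw [zOrbitSpan_comp_mul_right ι φ hy]
  infer_instance

/-- The `K`-translate span of `r(y) φ` is the `r(y)`-image of that of `φ` (for `y` centralising
`ι(H)`). Borel–Jacquet 1979, §4.3. [cite: BorelJacquet1979, §4.3] -/
theorem kTranslateSpan_comp_mul_right (φ : G → ℂ) {y : G}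
    (hy : ∀ h : H.carrier, ι h * y = y * ι h) :
    kTranslateSpan ι (fun g => φ (g * y)) = (kTranslateSpan ι φ).map (LinearMap.funLeft ℂ ℂ fun g : G => g * y) := by
  unfold kTranslateSpan
  rw [Submodule.map_span, ← Set.range_comp]
  congr 2
  funext k g
  simp only [Function.comp_apply, archTranslate_apply, LinearMap.funLeft_apply, mul_assoc, hy]

/-- **`K`-finiteness is preserved by right translations centralising `ι(H)`.**
Borel–Jacquet 1979, §4.3. [cite: BorelJacquet1979, §4.3] -/
theorem IsKFinite.comp_mul_right {φ : G → ℂ} (hφ : IsKFinite ι φ) {y : G}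
    (hy : ∀ h : H.carrier, ι h * y = y * ι h) : IsKFinite ι (fun g => φ (g * y)) := by
  unfold IsKFinite at hφ ⊢
  rw [kTranslateSpan_comp_mul_right ι φ hy]
  infer_instance

open scoped Matrix.Norms.Operator in
/-- **Archimedean smoothness is preserved by right translations centralising `ι(H)`**: the
archimedean slice of `r(y) φ` through `g` is the slice of `φ` through `g y`.
Borel–Jacquet 1979, §4.3. [cite: BorelJacquet1979, §4.3] -/
theorem IsArchSmooth.comp_mul_right {φ : G → ℂ} (hφ : IsArchSmooth ι φ) {y : G}
    (hy : ∀ h : H.carrier, ι h * y = y * ι h) : IsArchSmooth ι (fun g => φ (g * y)) := by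
  intro g
  have heq : (fun X : H.lie.toSubmodule => φ (g * ι (H.expMem ⟨X, X.2⟩) * y)) =
      fun X : H.lie.toSubmodule => φ (g * y * ι (H.expMem ⟨X, X.2⟩)) := by
    funext X
    rw [mul_assoc, hy, ← mul_assoc]
  rw [heq]
  exact hφ (g * y)

end ArchCalculus

/-! ### Invariance, levels, growth; the automorphic form `r(y) φ` -/

section Datum

variable {K : Type} [Field K] [NumberField K]
  {A : Type*} [NormedCommRing A] [NormedAlgebra ℝ A] [NormedAlgebra ℚ A] [CompleteSpace A]
  [StarRing A] {N : Type*} [Fintype N] [DecidableEq N]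
  {𝒢 : AdelicGroupData K} {𝒟 : AutomorphyDatum 𝒢 A N}

/-- Left `G(K)`-invariance is preserved by any right translation. Borel–Jacquet 1979, §4.2(a). [cite: BorelJacquet1979, §4.2] -/
theorem IsLeftInvariant.rightTranslation {φ : 𝒢.Adelic → ℂ} (hφ : IsLeftInvariant 𝒢 φ)
    (y : 𝒢.Adelic) : IsLeftInvariant 𝒢 (rightTranslation 𝒢 y φ) := by
  intro γ hγ g
  simp only [rightTranslation_apply, mul_assoc]
  exact hφ γ hγ (g * y)

/-- **Level invariance under conjugation of the level**: if `φ` is right `U`-invariant and every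
element of `U'` conjugates into `U` under `y` (`y⁻¹ u' y ∈ U`), then `r(y) φ` is right
`U'`-invariant. Borel–Jacquet 1979, §4.2(a) and §4.3. [cite: BorelJacquet1979, §4.3] -/
theorem IsRightInvariantUnder.rightTranslation {φ : 𝒢.Adelic → ℂ} {U U' : Subgroup 𝒢.Adelic}
    (hφ : IsRightInvariantUnder U φ) {y : 𝒢.Adelic} (hU' : ∀ u ∈ U', y⁻¹ * u * y ∈ U) :
    IsRightInvariantUnder U' (rightTranslation 𝒢 y φ) := by
  intro u hu g
  simp only [rightTranslation_apply]
  have : g * u * y = g * y * (y⁻¹ * u * y) := by group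
  rw [this]
  exact hφ _ (hU' u hu) _

/-- **Moderate growth is preserved by right translations under a linear height bound**: if
`1 ⊔ ‖g y‖ ≤ C (1 ⊔ ‖g‖)` for all `g`, then `r(y) φ` has moderate growth whenever `φ` does (same
exponent, constant multiplied by `C^r`). Borel–Jacquet 1979, §4.2(d) and §1.2 (property (ii) of
the height). [cite: BorelJacquet1979, §4.2] -/
theorem HasModerateGrowth.rightTranslation {φ : 𝒢.Adelic → ℂ} (hφ : HasModerateGrowth 𝒟 φ)
    {y : 𝒢.Adelic} {C : ℝ} (hC : ∀ g, 1 ⊔ 𝒟.height (g * y) ≤ C * (1 ⊔ 𝒟.height g)) :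
    HasModerateGrowth 𝒟 (rightTranslation 𝒢 y φ) := by
  obtain ⟨C₀, r, hφ⟩ := hφ
  have hpos : ∀ g, (0 : ℝ) < 1 ⊔ 𝒟.height g := fun g => lt_of_lt_of_le one_pos le_sup_left
  -- `C₀ ≥ 0` unless `G(𝔸)` is empty; we only need the bound at each `g`
  refine ⟨C₀ * C ^ r, r, fun g => ?_⟩
  rw [rightTranslation_apply]
  have h0 : 0 ≤ C₀ := by
    have := (norm_nonneg _).trans (hφ (g * y))
    exact nonneg_of_mul_nonneg_left this (pow_pos (hpos _) r)
  calc ‖φ (g * y)‖ ≤ C₀ * (1 ⊔ 𝒟.height (g * y)) ^ r := hφ (g * y)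
    _ ≤ C₀ * (C * (1 ⊔ 𝒟.height g)) ^ r := by
        refine mul_le_mul_of_nonneg_left (pow_le_pow_left₀ (hpos _).le (hC g) r) h0
    _ = C₀ * C ^ r * (1 ⊔ 𝒟.height g) ^ r := by rw [mul_pow, mul_assoc]

/-- **Right translates by elements centralising the archimedean group are automorphic forms**
(Borel–Jacquet 1979, 4.3, the `G(𝔸_f)`-stability of `𝒜`): let `y ∈ G(𝔸_K)` commute with
`ι(G_∞)`, let every level `U` of `𝒟` admit a level `U'` with `y⁻¹ U' y ⊆ U`, and let the height
satisfy `1 ⊔ ‖g y‖ ≤ C (1 ⊔ ‖g‖)`. Then `r(y) φ = (g ↦ φ (g y))` is an automorphic form for every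
automorphic form `φ`: left invariance is untouched, the level is conjugated, the archimedean
conditions (smoothness, `K_∞`- and `Z(𝔤)`-finiteness) commute with `r(y)`, and moderate growth
uses the height bound. [cite: BorelJacquet1979, 4.3] -/
theorem IsAutomorphicForm.rightTranslation_of_commute {φ : 𝒢.Adelic → ℂ}
    (hφ : IsAutomorphicForm 𝒟 φ) {y : 𝒢.Adelic}
    (hy : ∀ h : 𝒟.arch.carrier, 𝒟.ofArch h * y = y * 𝒟.ofArch h)
    (hlev : ∀ U ∈ 𝒟.finiteLevels, ∃ U' ∈ 𝒟.finiteLevels, ∀ u ∈ U', y⁻¹ * u * y ∈ U)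
    {C : ℝ} (hC : ∀ g, 1 ⊔ 𝒟.height (g * y) ≤ C * (1 ⊔ 𝒟.height g)) :
    IsAutomorphicForm 𝒟 (rightTranslation 𝒢 y φ) where
  leftInvariant := hφ.leftInvariant.rightTranslation y
  exists_level := by
    obtain ⟨U, hU, hφU⟩ := hφ.exists_level
    obtain ⟨U', hU', hconj⟩ := hlev U hU
    exact ⟨U', hU', hφU.rightTranslation hconj⟩
  archSmooth := hφ.archSmooth.comp_mul_right 𝒟.ofArch hy
  kFinite := hφ.kFinite.comp_mul_right 𝒟.ofArch hy
  zFinite := hφ.zFinite.comp_mul_right 𝒟.ofArch hy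
  moderateGrowth := hφ.moderateGrowth.rightTranslation hC

/-- **`𝒜 ≤ 𝒜.comap r(y)`**: under the hypotheses of `IsAutomorphicForm.rightTranslation_of_commute`
(`y` centralises `ι(G_∞)`, levels refine under `y`-conjugation, linear height bound), right
translation by `y` maps the space of automorphic forms (the span of the automorphic forms) into
itself — the form of Borel–Jacquet 1979, 4.3 consumed by `IsStableSubmodule.finite_stable`.
[cite: BorelJacquet1979, 4.3] -/
theorem automorphicForms_le_comap_rightTranslation {y : 𝒢.Adelic}
    (hy : ∀ h : 𝒟.arch.carrier, 𝒟.ofArch h * y = y * 𝒟.ofArch h)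
    (hlev : ∀ U ∈ 𝒟.finiteLevels, ∃ U' ∈ 𝒟.finiteLevels, ∀ u ∈ U', y⁻¹ * u * y ∈ U)
    {C : ℝ} (hC : ∀ g, 1 ⊔ 𝒟.height (g * y) ≤ C * (1 ⊔ 𝒟.height g)) :
    automorphicForms 𝒟 ≤ (automorphicForms 𝒟).comap (rightTranslation 𝒢 y) := by
  refine Submodule.span_le.2 fun φ hφ => ?_
  rw [SetLike.mem_coe, Submodule.mem_comap]
  exact (IsAutomorphicForm.rightTranslation_of_commute hφ hy hlev hC).mem_automorphicForms

end Datum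

end Literature.NumberTheory.Automorphic
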